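import Mathlib
import Summits.MatrixMultiplication.MatrixMultiplication.Theorems.FourierTwoFamiliesModPPrimeTwoFamiliesPaleyCapacityMinusOne

/-!
# The Golay certificate: `N(23, n) ≤ 7^n`, i.e. `Σ(P_23) ≤ log₂ 7`

Crux `PrimeTwoFamilies` (stmt-MatrixMultiplication-14308, route `FourierTwoFamiliesModP`), line `Sketch`, stub
`stub_paleyCapacity`; lead c4.

The rank certificates of `…PaleyCapacityMinusOne.lean` (`card_le_card_pow_of_vanishing_frequencies`: a set `K` of
frequencies whose character sums vanish on the non-zero squares bounds Paley–Sperner codes by `|K|^n`) are exactly the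
ODD-LIKE CODEWORDS OF QUADRATIC-RESIDUE-TYPE CYCLIC CODES: `∑_{k∈K} ζ^{ks} = 0` for all squares `s` says that the
polynomial `c(x) = ∑_{k∈K} x^k` vanishes on `{ζ^s : s square}`, i.e. `c` lies in the QR code with that zero set, and
`c(1) = |K| ≠ 0` says `c` is not in the even-like subcode.  Hence

  `Σ(P_q) ≤ log (minimum odd-like weight of a QR code of length q over any finite field)`.

For `q = 23` over `𝔽₂` this is the binary GOLAY code `[23, 12, 7]`: its generator polynomial
`g(x) = x^11 + x^10 + x^6 + x^5 + x^4 + x^2 + 1` has weight 7 and `g(1) = 1`, so `N(23, n) ≤ 7^n` and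
`Σ(P_23) ≤ log₂ 7 ≈ 2.807` — against Alon's `log₂ 12 ≈ 3.585`, the minus-one bound `log₂ 11`, and the lower bounds
`½ log₂ 23 ≈ 2.262`, `log₂ tt(23) = log₂ 5`.  In exponent: `Σ(P_23) / log 23 ≤ 0.6206`, the first bound for a Paley
tournament that is a POWER below Alon's.

Proof (no polynomial library; three ring identities in characteristic 2):
`(x-1)·g(x)·g*(x) = x^23 - 1` with `g*` the reciprocal of `g` (so for a primitive 23rd root `ζ₀` of unity in `𝔽̄₂`
either `g(ζ₀) = 0` or `g*(ζ₀) = 0`, and in the second case `g(ζ₀⁻¹) = 0` by `x^11 g(x⁻¹) = g*(x)`); `g(x^2) = g(x)^2`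
(Frobenius), so `g` vanishes at `ζ^(2^i)` for the good root `ζ`; and the powers of `2` modulo `23` are exactly the
eleven non-zero squares.
-/

-- the summit path `Summits/MatrixMultiplication/MatrixMultiplication/…` forces the repeated namespace segment
set_option linter.dupNamespace false

namespace Summit.MatrixMultiplication.MatrixMultiplication.Theorems.PrimeTwoFamilies.PaleyRankBound

open Finset

/-! Throughout, `g(x) = x^11 + x^10 + x^6 + x^5 + x^4 + x^2 + 1` (the Golay generator polynomial) and
`g*(x) = x^11 + x^9 + x^7 + x^6 + x^5 + x + 1` (its reciprocal) are written out as ring expressions; no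
definitions are introduced. -/

/-- `(x - 1) g(x) g*(x) = x^23 - 1` in characteristic `2` (over `ℤ` the difference is `2 P(x)` with
`P = x^18 - x^15 + x^14 + 2x^12 - 2x^11 - x^9 + x^8 - x^5`). -/
theorem golay_factorisation {R : Type*} [CommRing R] (h2 : (2 : R) = 0) (x : R) :
    (x - 1) * (x ^ 11 + x ^ 10 + x ^ 6 + x ^ 5 + x ^ 4 + x ^ 2 + 1) *
      (x ^ 11 + x ^ 9 + x ^ 7 + x ^ 6 + x ^ 5 + x + 1) = x ^ 23 - 1 := by
  linear_combination (x ^ 18 - x ^ 15 + x ^ 14 + 2 * x ^ 12 - 2 * x ^ 11 - x ^ 9 + x ^ 8 - x ^ 5) * h2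

/-- Frobenius: `g(x^2) = g(x)^2` in characteristic `2`. -/
theorem golayG_sq {R : Type*} [CommRing R] (h2 : (2 : R) = 0) (x : R) :
    ((x ^ 2) ^ 11 + (x ^ 2) ^ 10 + (x ^ 2) ^ 6 + (x ^ 2) ^ 5 + (x ^ 2) ^ 4 + (x ^ 2) ^ 2 + 1) =
      (x ^ 11 + x ^ 10 + x ^ 6 + x ^ 5 + x ^ 4 + x ^ 2 + 1) ^ 2 := by
  linear_combination (-(x ^ 21 + x ^ 17 + 2 * x ^ 16 + 2 * x ^ 15 + x ^ 14 + x ^ 13 + x ^ 12 + 2 * x ^ 11 +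
    2 * x ^ 10 + x ^ 9 + x ^ 8 + x ^ 7 + 2 * x ^ 6 + x ^ 5 + x ^ 4 + x ^ 2)) * h2

/-- The reciprocal relation `x^11 g(x⁻¹) = g*(x)` (`x ≠ 0`, any field). -/
theorem golayGstar_eq {F : Type*} [Field F] {x : F} (hx : x ≠ 0) :
    x ^ 11 * (x⁻¹ ^ 11 + x⁻¹ ^ 10 + x⁻¹ ^ 6 + x⁻¹ ^ 5 + x⁻¹ ^ 4 + x⁻¹ ^ 2 + 1) =
      (x ^ 11 + x ^ 9 + x ^ 7 + x ^ 6 + x ^ 5 + x + 1) := by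
  field_simp
  ring

/-- In characteristic `2`, some primitive 23rd root of unity `ζ` is a root of `g`, and then `g(ζ^(2^i)) = 0` for
all `i`. -/
theorem exists_primitiveRoot_golayG_eq_zero {F : Type*} [Field F] (h2 : (2 : F) = 0) {ζ₀ : F}
    (hζ₀ : IsPrimitiveRoot ζ₀ 23) : ∃ ζ : F, IsPrimitiveRoot ζ 23 ∧ ∀ i : ℕ,
      ((ζ ^ 2 ^ i) ^ 11 + (ζ ^ 2 ^ i) ^ 10 + (ζ ^ 2 ^ i) ^ 6 + (ζ ^ 2 ^ i) ^ 5 + (ζ ^ 2 ^ i) ^ 4 +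
        (ζ ^ 2 ^ i) ^ 2 + 1) = 0 := by
  -- `g` as a function, locally
  let g : F → F := fun x => (x ^ 11 + x ^ 10 + x ^ 6 + x ^ 5 + x ^ 4 + x ^ 2 + 1)
  change ∃ ζ : F, IsPrimitiveRoot ζ 23 ∧ ∀ i : ℕ, g (ζ ^ 2 ^ i) = 0
  have hgsq : ∀ x : F, g (x ^ 2) = g x ^ 2 := fun x => golayG_sq h2 x
  -- a primitive root `ζ` with `g ζ = 0`
  have hroot : ∃ ζ : F, IsPrimitiveRoot ζ 23 ∧ g ζ = 0 := by
    have h0 : (ζ₀ - 1) * g ζ₀ * (ζ₀ ^ 11 + ζ₀ ^ 9 + ζ₀ ^ 7 + ζ₀ ^ 6 + ζ₀ ^ 5 + ζ₀ + 1) = 0 := by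
      rw [golay_factorisation h2, hζ₀.pow_eq_one, sub_self]
    have hne1 : ζ₀ - 1 ≠ 0 := sub_ne_zero.mpr (hζ₀.ne_one (by norm_num))
    rcases mul_eq_zero.1 h0 with h01 | hstar
    · exact ⟨ζ₀, hζ₀, (mul_eq_zero.1 h01).resolve_left hne1⟩
    · have hz : ζ₀ ≠ 0 := hζ₀.ne_zero (by norm_num)
      refine ⟨ζ₀⁻¹, hζ₀.inv, ?_⟩
      have h := golayGstar_eq hz
      rw [hstar] at h
      exact (mul_eq_zero.1 h).resolve_left (pow_ne_zero _ hz)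
  obtain ⟨ζ, hζ, hg⟩ := hroot
  refine ⟨ζ, hζ, fun i => ?_⟩
  induction i with
  | zero => simpa using hg
  | succ i ih => rw [pow_succ, pow_mul, hgsq, ih, zero_pow two_ne_zero]

/-- The eleven non-zero squares modulo `23` are the powers of `2`: every non-zero square `d : ZMod 23` has
`d.val = 2^i % 23` for some `i < 11`. -/
theorem sq_val_eq_two_pow_mod_23 :
    ∀ r : ZMod 23, r * r ≠ 0 → ∃ i : Fin 11, (r * r).val = 2 ^ (i : ℕ) % 23 := by
  decide

/-- **The Golay certificate: `N(23, n) ≤ 7^n`.**  A set `S ⊆ (ZMod 23)^n` of words in which every ordered pair of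
distinct words `(u, v)` has a coordinate `i` with `v i - u i` a non-zero square has at most `7^n` elements; hence the
Sperner capacity of the Paley tournament `P_23` is at most `log₂ 7` (exponent `log 7 / log 23 < 0.621`). -/
theorem card_le_seven_pow_of_paley_23_sperner {n : ℕ} (S : Finset (Fin n → ZMod 23))
    (hS : ∀ u ∈ S, ∀ v ∈ S, u ≠ v → ∃ i, u i ≠ v i ∧ IsSquare (v i - u i)) :
    S.card ≤ 7 ^ n := by
  classical
  haveI : Fact (Nat.Prime 2) := ⟨Nat.prime_two⟩
  let F := AlgebraicClosure (ZMod 2)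
  have h2 : (2 : F) = 0 := by
    have h := map_natCast (algebraMap (ZMod 2) F) 2
    rw [ZMod.natCast_self, map_zero] at h
    exact_mod_cast h.symm
  haveI : NeZero ((23 : ℕ) : ZMod 2) := ⟨by rw [Ne, ZMod.natCast_eq_zero_iff]; norm_num⟩
  obtain ⟨ζ₀, hζ₀⟩ := HasEnoughRootsOfUnity.exists_primitiveRoot F 23
  obtain ⟨ζ, hζ, hgz⟩ := exists_primitiveRoot_golayG_eq_zero h2 hζ₀
  let ψ : AddChar (ZMod 23) F := AddChar.zmodChar 23 hζ.pow_eq_one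
  let K : Finset (ZMod 23) := {0, 2, 4, 5, 6, 10, 11}
  have hKcard : K.card = 7 := by decide
  have hpowmod : ∀ m : ℕ, ζ ^ (m % 23) = ζ ^ m := fun m => by
    conv_rhs => rw [← Nat.div_add_mod m 23, pow_add, pow_mul, hζ.pow_eq_one, one_pow, one_mul]
  -- the character sums over `K` are the values `g(ζ^{d})`
  let g : F → F := fun x => (x ^ 11 + x ^ 10 + x ^ 6 + x ^ 5 + x ^ 4 + x ^ 2 + 1)
  have hsumK : ∀ d : ZMod 23, ∑ k ∈ K, ψ (k * d) = g (ζ ^ d.val) := by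
    intro d
    have hterm : ∀ k : ℕ, k < 23 → ψ ((k : ZMod 23) * d) = (ζ ^ d.val) ^ k := by
      intro k hk
      show ζ ^ ((k : ZMod 23) * d).val = (ζ ^ d.val) ^ k
      rw [ZMod.val_mul, ZMod.val_natCast, Nat.mod_eq_of_lt hk, hpowmod, ← pow_mul, mul_comm]
    have e0 := hterm 0 (by norm_num)
    have e2 := hterm 2 (by norm_num)
    have e4 := hterm 4 (by norm_num)
    have e5 := hterm 5 (by norm_num)
    have e6 := hterm 6 (by norm_num)
    have e10 := hterm 10 (by norm_num)
    have e11 := hterm 11 (by norm_num)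
    simp only [Nat.cast_ofNat, Nat.cast_zero] at e0 e2 e4 e5 e6 e10 e11
    rw [show K = {0, 2, 4, 5, 6, 10, 11} from rfl]
    rw [Finset.sum_insert (by decide), Finset.sum_insert (by decide), Finset.sum_insert (by decide),
      Finset.sum_insert (by decide), Finset.sum_insert (by decide), Finset.sum_insert (by decide),
      Finset.sum_singleton, e0, e2, e4, e5, e6, e10, e11]
    simp only [g]
    ring
  have hK0 : ((K.card : ℕ) : F) ≠ 0 := by
    rw [hKcard, show ((7 : ℕ) : F) = 2 * 3 + 1 by norm_num, h2, zero_mul, zero_add]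
    exact one_ne_zero
  have hvan : ∀ d : ZMod 23, d ≠ 0 → IsSquare d → ∑ k ∈ K, ψ (k * d) = 0 := by
    intro d hd hsq
    obtain ⟨r, rfl⟩ := hsq
    obtain ⟨i, hi⟩ := sq_val_eq_two_pow_mod_23 r hd
    rw [hsumK, hi, hpowmod]
    exact hgz i
  rw [← hKcard]
  exact card_le_card_pow_of_vanishing_frequencies ψ K hK0 hvan S hS

/-- The same in the `Fin 23`-valued vocabulary of `stub_paleyCapacity`. -/
theorem card_le_seven_pow_of_paley_23_sperner_fin {n : ℕ} (W : Finset (Fin n → Fin 23))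
    (hW : ∀ u ∈ W, ∀ w ∈ W, u ≠ w →
      ∃ t : Fin n, u t ≠ w t ∧ IsSquare (((w t : ℕ) : ZMod 23) - ((u t : ℕ) : ZMod 23))) :
    W.card ≤ 7 ^ n := by
  classical
  let φ : (Fin n → Fin 23) → (Fin n → ZMod 23) := fun w t => ((w t : ℕ) : ZMod 23)
  have hcast : ∀ a b : Fin 23, ((a : ℕ) : ZMod 23) = ((b : ℕ) : ZMod 23) → a = b := by
    intro a b h
    apply Fin.ext
    have := (ZMod.natCast_eq_natCast_iff' a b 23).mp h
    rwa [Nat.mod_eq_of_lt a.isLt, Nat.mod_eq_of_lt b.isLt] at this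
  have hφ : Function.Injective φ := fun a b h => funext fun t => hcast _ _ (congrFun h t)
  rw [← Finset.card_image_of_injective W hφ]
  refine card_le_seven_pow_of_paley_23_sperner (W.image φ) ?_
  simp only [Finset.mem_image]
  rintro _ ⟨u, hu, rfl⟩ _ ⟨w, hw, rfl⟩ hne
  have hne' : u ≠ w := fun e => hne (by rw [e])
  obtain ⟨t, ht, hsq⟩ := hW u hu w hw hne'
  exact ⟨t, fun e => ht (hcast _ _ e), hsq⟩

end Summit.MatrixMultiplication.MatrixMultiplication.Theorems.PrimeTwoFamilies.PaleyRankBound
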